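import Summits.KontsevichZagierPeriods.KontsevichZagierPeriods.Theorems.SoloBlindQuarticPrep
import Summits.KontsevichZagierPeriods.KontsevichZagierPeriods.Theorems.SoloBlindTriplication
import HarnessLib

/-!
# The Aoki–Shioda quartic family inside the Kontsevich–Zagier rules, II: the moves

(solo programme `solo-KontsevichZagierPeriods-blind`, session 11; Part I is `SoloBlindQuarticPrep`)

With the maps `φ_A, φ_B, ψ : (0,1) → (0,1)` and the integrands `G_A, G_B, G_C` of Part I:
three substitutions and one integrand additivity give, for every rational `0 < x < 1/4`,

  `β(x, 1-4x) = β(1-4x, 3x) + 2·64^{-x} • β(3x, ½-x)`   (`betaQ_quartic`)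

in `Q = (formal integral representations)/(KZ relations)`, and with one `S₃`-orbit relation

  `β(x, 1-4x) ≐ β(3x, ½-x)`   (`betaQ_propTo_quartic`):

the orbit of `{x, 3x, 1-4x}` merges with the orbit of `{3x, ½-x, ½-2x}` — uniformly in `x`.
Together with duplication (the quadric family) and triplication (`SoloBlindTriplication`, the
cubic family) this puts all three isogeny families of Aoki–Shioda inside the rules; the instances
at levels `16, 20, 24` listed at the end were isolated classes of the move census before.
-/

noncomputable section

open Set MeasureTheory MvPolynomial

namespace Summit.KontsevichZagierPeriods.KontsevichZagierPeriods.Theorems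

namespace SoloBlind

open Literature.ModelTheory.ExponentialFields (IsSemialgebraic)
open Literature.NumberTheory.Transcendental
open Literature.NumberTheory.Transcendental.KZ

/-! ## Integrability (transport of the Beta integrands) -/

/-- `quGA x` is integrable on `(0,1)` for `0 < x < 1/4`. -/
theorem integrableOn_quGA (x : ℚ) (hx : 0 < x) (hx4 : 4 * x < 1) :
    IntegrableOn (quGA x) (Ioo 0 1) := by
  have h := integrableOn_betaFun (1 - 4 * x) (3 * x) (by linarith) (by positivity)
  rw [image_quA, integrableOn_image_iff_integrableOn_abs_deriv_smul measurableSet_Ioo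
    (fun m _ => (hasDerivAt_quA m).hasDerivWithinAt) injOn_quA] at h
  exact h.congr_fun (fun m hm => by simp only [smul_eq_mul]; rw [mul_comm, ← qu_pullA x hm])
    measurableSet_Ioo

/-- `quGB x` is integrable on `(0,1)` for `0 < x < 1/4`. -/
theorem integrableOn_quGB (x : ℚ) (hx : 0 < x) (hx4 : 4 * x < 1) :
    IntegrableOn (quGB x) (Ioo 0 1) := by
  have h := integrableOn_betaFun x (1 - 4 * x) hx (by linarith)
  rw [image_quB, integrableOn_image_iff_integrableOn_abs_deriv_smul measurableSet_Ioo
    (fun m _ => (hasDerivAt_quB m).hasDerivWithinAt) injOn_quB] at h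
  exact h.congr_fun (fun m hm => by simp only [smul_eq_mul]; rw [mul_comm, ← qu_pullB x hm])
    measurableSet_Ioo

/-- `quGC x` is integrable on `(0,1)` for `0 < x < 1/2`. -/
theorem integrableOn_quGC (x : ℚ) (hx : 0 < x) (hx2 : x < 1 / 2) :
    IntegrableOn (quGC x) (Ioo 0 1) := by
  have h := integrableOn_betaFun (3 * x) (1 / 2 - x) (by positivity) (by linarith)
  rw [image_quS, integrableOn_image_iff_integrableOn_abs_deriv_smul measurableSet_Ioo
    (fun m _ => (hasDerivAt_quS m).hasDerivWithinAt) injOn_quS] at h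
  exact h.congr_fun (fun m hm => by simp only [smul_eq_mul]; rw [mul_comm, ← qu_pullC x hm])
    measurableSet_Ioo

/-! ## Semialgebraicity -/

/-- `φ_A` is `ℚ`-semialgebraic on `(0,1)`. -/
theorem sa_quA : IsSemialgebraicFunOn ℚ (line (Ioo (0:ℝ) 1)) (fun v : Fin 1 → ℝ => quA (v 0)) :=
  (isSemialgebraicFunOn_aeval mix_line_sa ((1 - X 0) * (1 + X 0 ^ 2) : MvPolynomial (Fin 1) ℚ)).congr
    fun v _ => by simp [quA]

/-- `φ_B` is `ℚ`-semialgebraic on `(0,1)`. -/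
theorem sa_quB : IsSemialgebraicFunOn ℚ (line (Ioo (0:ℝ) 1)) (fun v : Fin 1 → ℝ => quB (v 0)) :=
  IsSemialgebraicFunOn.div
    ((isSemialgebraicFunOn_aeval mix_line_sa (X 0 ^ 3 : MvPolynomial (Fin 1) ℚ)).congr
      fun v _ => by simp)
    ((isSemialgebraicFunOn_aeval mix_line_sa (X 0 ^ 2 - X 0 + 1 : MvPolynomial (Fin 1) ℚ)).congr
      fun v _ => by simp)
    fun v _ => (ReflectionThird.sq_sub_add_one_pos (v 0)).ne'

/-- `ψ` is `ℚ`-semialgebraic on `(0,1)`. -/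
theorem sa_quS : IsSemialgebraicFunOn ℚ (line (Ioo (0:ℝ) 1)) (fun v : Fin 1 → ℝ => quS (v 0)) :=
  IsSemialgebraicFunOn.div
    ((isSemialgebraicFunOn_aeval mix_line_sa
      (4 * (X 0 * (X 0 ^ 2 - X 0 + 1)) : MvPolynomial (Fin 1) ℚ)).congr fun v _ => by simp)
    ((isSemialgebraicFunOn_aeval mix_line_sa ((1 + X 0 ^ 2) ^ 2 : MvPolynomial (Fin 1) ℚ)).congr
      fun v _ => by simp)
    fun v _ => by positivity

/-- `Φ^x` is `ℚ`-semialgebraic on `(0,1)`. -/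
theorem sa_quPhi_rpow (x : ℚ) :
    IsSemialgebraicFunOn ℚ (line (Ioo (0:ℝ) 1)) (fun v : Fin 1 → ℝ => quPhi (v 0) ^ (x : ℝ)) := by
  have hPhi : IsSemialgebraicFunOn ℚ (line (Ioo (0:ℝ) 1)) (fun v : Fin 1 → ℝ => quPhi (v 0)) :=
    IsSemialgebraicFunOn.div
      ((isSemialgebraicFunOn_aeval mix_line_sa
        ((X 0 * (X 0 ^ 2 - X 0 + 1)) ^ 3 : MvPolynomial (Fin 1) ℚ)).congr
        fun v _ => by simp [quD])
      ((isSemialgebraicFunOn_aeval mix_line_sa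
        (((1 - X 0) * (1 + X 0 ^ 2)) ^ 4 : MvPolynomial (Fin 1) ℚ)).congr
        fun v _ => by simp [quA])
      fun v hv => by
        have hv : v 0 ∈ Ioo (0:ℝ) 1 := hv
        exact (pow_pos (quA_pos hv) 4).ne'
  exact IsSemialgebraicFunOn.rpow_ratCast mix_line_sa hPhi (fun v hv => quPhi_pos hv) x

/-- `Φ^x · p(m) / D` is `ℚ`-semialgebraic on `(0,1)` for a polynomial `p`. -/
theorem sa_quPhi_rpow_mul_div (x : ℚ) (p : MvPolynomial (Fin 1) ℚ) :
    IsSemialgebraicFunOn ℚ (line (Ioo (0:ℝ) 1))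
      (fun v : Fin 1 → ℝ => quPhi (v 0) ^ (x : ℝ) * aeval v p / quD (v 0)) :=
  IsSemialgebraicFunOn.div
    (IsSemialgebraicFunOn.mul_holds (sa_quPhi_rpow x) (isSemialgebraicFunOn_aeval mix_line_sa p))
    ((isSemialgebraicFunOn_aeval mix_line_sa
      (X 0 * (X 0 ^ 2 - X 0 + 1) : MvPolynomial (Fin 1) ℚ)).congr fun v _ => by simp [quD])
    fun v hv => (quD_pos (show v 0 ∈ Ioo (0:ℝ) 1 from hv)).ne'

/-- `quGA x` is `ℚ`-semialgebraic on `(0,1)`. -/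
theorem sa_quGA (x : ℚ) :
    IsSemialgebraicFunOn ℚ (line (Ioo (0:ℝ) 1)) (fun v : Fin 1 → ℝ => quGA x (v 0)) :=
  (sa_quPhi_rpow_mul_div x (3 * X 0 ^ 2 - 2 * X 0 + 1)).congr fun v _ => by simp [quGA]

/-- `quGB x` is `ℚ`-semialgebraic on `(0,1)`. -/
theorem sa_quGB (x : ℚ) :
    IsSemialgebraicFunOn ℚ (line (Ioo (0:ℝ) 1)) (fun v : Fin 1 → ℝ => quGB x (v 0)) :=
  (sa_quPhi_rpow_mul_div x (X 0 ^ 2 - 2 * X 0 + 3)).congr fun v _ => by simp [quGB]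

/-- `64^x` is real algebraic for rational `x`. -/
theorem qu_isAlgebraic_rpow (x : ℚ) : IsAlgebraic ℚ ((64:ℝ) ^ (x : ℝ)) :=
  Literature.NumberTheory.Transcendental.isAlgebraic_rpow_ratCast
    (by simpa using isAlgebraic_rat ℚ (A := ℝ) 64) (by norm_num) x

/-- `quGC x` is `ℚ`-semialgebraic on `(0,1)`. -/
theorem sa_quGC (x : ℚ) :
    IsSemialgebraicFunOn ℚ (line (Ioo (0:ℝ) 1)) (fun v : Fin 1 → ℝ => quGC x (v 0)) :=
  (IsSemialgebraicFunOn.mul_holds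
    (isSemialgebraicFunOn_const_of_isAlgebraic mix_line_sa (qu_isAlgebraic_rpow x))
    (sa_quPhi_rpow_mul_div x (1 - X 0 ^ 2))).congr fun v _ => by simp [quGC]

/-! ## The coefficient `c_x = 2·64^{-x}` -/

/-- `2·64^{-x}` is algebraic. -/
theorem isAlgebraic_quC (x : ℚ) : IsAlgebraic ℚ (2 * (64:ℝ) ^ (-(x : ℝ))) := by
  have h := qu_isAlgebraic_rpow (-x)
  push_cast at h
  exact IsAlgebraic.mul (by simpa using isAlgebraic_rat ℚ (A := ℝ) 2) h

/-- `c_x = 2·64^{-x}` as an element of `K₀ = ℚ̄ ∩ ℝ`. -/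
def quCK (x : ℚ) : K₀ := ⟨2 * (64:ℝ) ^ (-(x : ℝ)), mem_K₀_iff.mpr (isAlgebraic_quC x)⟩

/-- `(c_x : ℝ) = 2·64^{-x}`. -/
@[simp] theorem coe_quCK (x : ℚ) : ((quCK x : K₀) : ℝ) = 2 * (64:ℝ) ^ (-(x : ℝ)) := rfl

/-- `c_x ≠ 0`. -/
theorem quCK_ne_zero (x : ℚ) : quCK x ≠ 0 := by
  intro h
  have h' := congrArg (fun z : K₀ => (z : ℝ)) h
  simp only [coe_quCK, ZeroMemClass.coe_zero] at h'
  have : (0:ℝ) < 2 * (64:ℝ) ^ (-(x : ℝ)) := by positivity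
  linarith

/-! ## The representations (all on the line `(0,1)`) -/

/-- `R_A = [(0,1), G_A]`. -/
def quRA (x : ℚ) (hx : 0 < x) (hx4 : 4 * x < 1) : IntegralRep 1 :=
  lineRep (Ioo 0 1) (quGA x) mix_line_sa (sa_quGA x) (integrableOn_quGA x hx hx4)

/-- `R_B = [(0,1), G_B]`. -/
def quRB (x : ℚ) (hx : 0 < x) (hx4 : 4 * x < 1) : IntegralRep 1 :=
  lineRep (Ioo 0 1) (quGB x) mix_line_sa (sa_quGB x) (integrableOn_quGB x hx hx4)

/-- `R_C = [(0,1), G_C]`. -/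
def quRC (x : ℚ) (hx : 0 < x) (hx4 : 4 * x < 1) : IntegralRep 1 :=
  lineRep (Ioo 0 1) (quGC x) mix_line_sa (sa_quGC x) (integrableOn_quGC x hx (by linarith))

/-! ## The moves -/

/-- **Move A:** `R_A ≡ β(1-4x, 3x)` (substitution `σ = φ_A(m)`). -/
theorem quRA_sub_betaRep (x : ℚ) (hx : 0 < x) (hx4 : 4 * x < 1) :
    of (quRA x hx hx4) - of (betaRep (1 - 4 * x) (3 * x) (by linarith) (by positivity)) ∈
      relations := by
  unfold quRA betaRep
  exact lineRep_subst quA quA' sa_quA (fun m _ => (hasDerivAt_quA m).hasDerivWithinAt) injOn_quA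
    image_quA (fun m hm => qu_pullA x hm)

/-- **Move B:** `R_B ≡ β(x, 1-4x)` (substitution `σ = φ_B(m)`). -/
theorem quRB_sub_betaRep (x : ℚ) (hx : 0 < x) (hx4 : 4 * x < 1) :
    of (quRB x hx hx4) - of (betaRep x (1 - 4 * x) hx (by linarith)) ∈ relations := by
  unfold quRB betaRep
  exact lineRep_subst quB quB' sa_quB (fun m _ => (hasDerivAt_quB m).hasDerivWithinAt) injOn_quB
    image_quB (fun m hm => qu_pullB x hm)

/-- **Move C:** `R_C ≡ β(3x, ½-x)` (substitution `s = ψ(m)`). -/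
theorem quRC_sub_betaRep (x : ℚ) (hx : 0 < x) (hx4 : 4 * x < 1) :
    of (quRC x hx hx4) - of (betaRep (3 * x) (1 / 2 - x) (by positivity) (by linarith)) ∈
      relations := by
  unfold quRC betaRep
  exact lineRep_subst quS quS' sa_quS (fun m _ => (hasDerivAt_quS m).hasDerivWithinAt) injOn_quS
    image_quS (fun m hm => qu_pullC x hm)

/-- **Move D (integrand additivity):** `R_B ≡ R_A + c_x · R_C`. -/
theorem quRB_sub_sub (x : ℚ) (hx : 0 < x) (hx4 : 4 * x < 1) :
    of (quRB x hx hx4) - of (quRA x hx hx4) -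
      of ((quRC x hx hx4).constMul (2 * (64:ℝ) ^ (-(x : ℝ))) (isAlgebraic_quC x)) ∈ relations :=
  of_sub_sub_mem_relations_of_add rfl rfl fun v _ => by
    simp only [quRA, quRB, quRC, lineRep_integrand, IntegralRep.integrand_constMul]
    exact qu_add x (v 0)

/-! ## In `Q` -/

/-- `[R_A] = β(1-4x, 3x)`. -/
theorem quRA_eq (x : ℚ) (hx : 0 < x) (hx4 : 4 * x < 1) :
    mkQ (of (quRA x hx hx4)) = betaQ (1 - 4 * x) (3 * x) := by
  rw [betaQ_eq (by linarith) (by positivity)]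
  exact mkQ_eq_mkQ_iff.mpr (quRA_sub_betaRep x hx hx4)

/-- `[R_C] = β(3x, ½-x)`. -/
theorem quRC_eq (x : ℚ) (hx : 0 < x) (hx4 : 4 * x < 1) :
    mkQ (of (quRC x hx hx4)) = betaQ (3 * x) (1 / 2 - x) := by
  rw [betaQ_eq (by positivity) (by linarith)]
  exact mkQ_eq_mkQ_iff.mpr (quRC_sub_betaRep x hx hx4)

/-- **The quartic family inside the Kontsevich–Zagier rules:**
`β(x, 1-4x) = β(1-4x, 3x) + 2·64^{-x} • β(3x, ½-x)` for rational `0 < x < 1/4`. -/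
theorem betaQ_quartic (x : ℚ) (hx : 0 < x) (hx4 : 4 * x < 1) :
    betaQ x (1 - 4 * x) = betaQ (1 - 4 * x) (3 * x) + quCK x • betaQ (3 * x) (1 / 2 - x) := by
  have hB : betaQ x (1 - 4 * x) = mkQ (of (quRB x hx hx4)) := by
    rw [betaQ_eq hx (by linarith)]
    exact (mkQ_eq_mkQ_iff.mpr (quRB_sub_betaRep x hx hx4)).symm
  have h2 : mkQ (of (quRB x hx hx4)) = mkQ (of (quRA x hx hx4)) +
      mkQ (of ((quRC x hx hx4).constMul (2 * (64:ℝ) ^ (-(x : ℝ))) (isAlgebraic_quC x))) := by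
    rw [← map_add, mkQ_eq_mkQ_iff]
    have h := quRB_sub_sub x hx hx4
    rwa [sub_sub] at h
  have hC : mkQ (of ((quRC x hx hx4).constMul (2 * (64:ℝ) ^ (-(x : ℝ))) (isAlgebraic_quC x))) =
      quCK x • betaQ (3 * x) (1 / 2 - x) := by
    rw [mkQ_constMul, quRC_eq]
    rfl
  rw [hB, h2, quRA_eq, hC]

/-- Period check: `B(x,1-4x) = B(1-4x,3x) + 2·64^{-x} B(3x,½-x)`. -/
theorem beta_quartic_value (x : ℚ) (hx : 0 < x) (hx4 : 4 * x < 1) :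
    evalQ (betaQ x (1 - 4 * x)) =
      evalQ (betaQ (1 - 4 * x) (3 * x)) + 2 * (64:ℝ) ^ (-(x : ℝ)) * evalQ (betaQ (3 * x) (1 / 2 - x)) := by
  rw [betaQ_quartic x hx hx4, map_add, evalQ_smul, coe_quCK]

/-! ## The orbit merge -/

/-- `sin(πq) - sin(πp) ≠ 0` for `0 < p < q` with `p + q < 1` (indeed `sin(πp) < sin(πq)`). -/
theorem sinQ_sub_sinQ_ne_zero_of_lt {p q : ℚ} (hp0 : 0 < p) (hpq : p < q) (h1 : p + q < 1) :
    sinQ q - sinQ p ≠ 0 := by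
  intro h
  have h' := congrArg (fun z : K₀ => (z : ℝ)) h
  simp only [AddSubgroupClass.coe_sub, sinQ_val, ZeroMemClass.coe_zero] at h'
  have hp : (0:ℝ) < p := by exact_mod_cast hp0
  have hpq' : (p:ℝ) < q := by exact_mod_cast hpq
  have h1' : (p:ℝ) + q < 1 := by exact_mod_cast h1
  have hπ := Real.pi_pos
  have hlt : Real.sin (Real.pi * p) < Real.sin (Real.pi * q) := by
    by_cases hq : (q:ℝ) ≤ 1 / 2
    · exact Real.sin_lt_sin_of_lt_of_le_pi_div_two (by nlinarith) (by nlinarith) (by nlinarith)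
    · push Not at hq
      rw [← Real.sin_pi_sub (Real.pi * q), show Real.pi - Real.pi * q = Real.pi * (1 - q) by ring]
      exact Real.sin_lt_sin_of_lt_of_le_pi_div_two (by nlinarith) (by nlinarith) (by nlinarith)
  linarith

/-- **Quartic merge: `β(x, 1-4x) ≐ β(3x, ½-x)`** — the orbit of `{x, 3x, 1-4x}` meets the orbit
of `{3x, ½-x, ½-2x}`, for every rational `0 < x < 1/4`.  Precisely
`(sin 3πx - sin πx) • β(x, 1-4x) = (2·64^{-x} sin 3πx) • β(3x, ½-x)`. -/
theorem betaQ_propTo_quartic (x : ℚ) (hx : 0 < x) (hx4 : 4 * x < 1) :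
    PropTo (betaQ x (1 - 4 * x)) (betaQ (3 * x) (1 / 2 - x)) := by
  have key := betaQ_quartic x hx hx4
  have hp := orbit_pair (1 - 4 * x) x (3 * x) (by linarith) hx (by positivity) (by ring)
  rw [betaQ_symm (show (0:ℚ) < 1 - 4 * x by linarith) hx] at hp
  have key' : sinQ (3 * x) • betaQ x (1 - 4 * x) = sinQ (3 * x) • betaQ (1 - 4 * x) (3 * x) +
      (sinQ (3 * x) * quCK x) • betaQ (3 * x) (1 / 2 - x) := by
    rw [key, smul_add, smul_smul]
  rw [hp] at key'
  refine PropTo.of_smul_eq_smul (c := sinQ (3 * x) - sinQ x) (c' := sinQ (3 * x) * quCK x)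
    (sinQ_sub_sinQ_ne_zero_of_lt hx (by linarith) (by linarith))
    (mul_ne_zero (sinQ_ne_zero (by positivity) (by linarith)) (quCK_ne_zero x)) ?_
  linear_combination (norm := module) key'

/-! ## Instances: formerly isolated classes of the move census -/

/-- Level `16`: `β(1/16, 3/4) ≐ β(3/16, 7/16)` — `{1,3,12}` meets `{3,6,7}`. -/
theorem betaQ_propTo_sixteen_1 : PropTo (betaQ (1 / 16) (3 / 4)) (betaQ (3 / 16) (7 / 16)) := by
  have h := betaQ_propTo_quartic (1 / 16) (by norm_num) (by norm_num)
  norm_num at h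
  exact h

/-- Level `16`: `β(3/16, 1/4) ≐ β(9/16, 5/16)` — `{3,4,9}` meets `{2,5,9}`. -/
theorem betaQ_propTo_sixteen_3 : PropTo (betaQ (3 / 16) (1 / 4)) (betaQ (9 / 16) (5 / 16)) := by
  have h := betaQ_propTo_quartic (3 / 16) (by norm_num) (by norm_num)
  norm_num at h
  exact h

/-- Level `20`: `β(3/20, 2/5) ≐ β(9/20, 7/20)` — `{3,8,9}` meets `{4,7,9}`. -/
theorem betaQ_propTo_twenty_3 : PropTo (betaQ (3 / 20) (2 / 5)) (betaQ (9 / 20) (7 / 20)) := by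
  have h := betaQ_propTo_quartic (3 / 20) (by norm_num) (by norm_num)
  norm_num at h
  exact h

/-- Level `24`: `β(1/24, 5/6) ≐ β(1/8, 11/24)` — `{1,3,20}` meets `{3,10,11}`. -/
theorem betaQ_propTo_twentyfour_1 : PropTo (betaQ (1 / 24) (5 / 6)) (betaQ (1 / 8) (11 / 24)) := by
  have h := betaQ_propTo_quartic (1 / 24) (by norm_num) (by norm_num)
  norm_num at h
  exact h

/-- Level `24`: `β(5/24, 1/6) ≐ β(5/8, 7/24)` — `{4,5,15}` meets `{2,7,15}`. -/
theorem betaQ_propTo_twentyfour_5 : PropTo (betaQ (5 / 24) (1 / 6)) (betaQ (5 / 8) (7 / 24)) := by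
  have h := betaQ_propTo_quartic (5 / 24) (by norm_num) (by norm_num)
  norm_num at h
  exact h

end SoloBlind

end Summit.KontsevichZagierPeriods.KontsevichZagierPeriods.Theorems
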